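import Summits.ABC.StewartYu.ArchG3RecSiegelAtoms
import Summits.ABC.StewartYu.ArchG3RecEndC
import Summits.ABC.StewartYu.ArchG3RecEndNum
import Summits.ABC.StewartYu.ArchG3RecLinesB
import HarnessLib

/-!
# The archimedean record `ArchG3Rec` — the unit `Z = G·X·L` against the negated bound `U₀ = cⁿ·Ω·W` (seam (B)(ii) of `stub_recLinesArch`,
# plan R48: the U₀-dominated conjuncts; cell abc-stewartyu, crux r2 `ArchCoreRat` stmt-ABC-20502, seat p4 g10)

Support file (elementary theorems; no named facts, no definitions).  The closed letter lines of p5's `ArchG3Rec.LinesClosed(K)` carry, in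
their (J)/(C) conjuncts and smallness side conditions, the smallness letter `−U₀ = −cⁿ·Ω·W` (the negated crux bound, `δ₀ = exp(−U₀)`)
against costs that the record measures in the unit `Z = G·X·L` (p1's atom bounds).  This file supplies the ONE comparison between the two
currencies, uniformly in `n ≥ 2` and in the data:

* `WN_le` — `W_N ≤ W + 2n + log Ω`; `Sd_real_le` — `Ŝ ≤ 14n + 40 + log N/log 2`; `X_real_le` — `X ≤ 8·W_N + (3/2)(n+1)L/(C_bⁿΩK) + 64(n+1) + 2`;
  `L_real_le_sum` — `L ≤ main + 2^{n+25} + 2A_max/N + 4(Ŝ+2) + 3` with `main = 24C_bⁿΩK·yload_K·W/(G·W_N)`;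
* `L_le_CbK` — `L ≤ 384·C_bⁿK·Ω`; `WN_mul_L_le` — `W_N·L ≤ 1300(n+1)²·C_bⁿK·Ω·W`; **`XL_le`** — `X·L ≤ 2^{18}·(n+1)²·C_bⁿK·Ω·W` (the balanced design `X·L ≍ Ω·W`: `W_N` cancels in `X·main`, `log N/N ≤ 1` in the
  `A_max/N` floor, `√Ω·√Ω = Ω` in the depth floor); **`Z_le`** — `Z ≤ 2^{21}·(n+1)³·C_bⁿK·Ω·W`;
* **`Z_le_U0` / `U0_ge`** (THE U₀-DOMINATION LEMMA, plan R50) — for every `k` and `c ≥ 2^{k+60}`: `2^{k·n}·Z ≤ U₀(c) = cⁿ·Ω·W` (so a family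
  file bounding its costs by `2^{k·n}·Z` is paid by `U₀` at the floor `c₀ = 2^{k+60}`); `U_le_U0` — `2^{k·n}·C_bⁿK·Ω·W ≤ U₀(c)` for `c ≥ 2^{k+36}`.

WHAT THIS IS NOT: no letter line by itself (those are p1's (F) lines and the (J)/(C) assembly); no crux moves.

References: Yu. V. Nesterenko, LNM 1819 (2003), §3.5 (3.23)–(3.25), §4 (4.3)–(4.5); E. M. Matveev, Izv. Math. 64 (2000), §3.
-/

noncomputable section

open Finset Real

namespace Summit.ABC.StewartYu

namespace ArchG3Rec

open PadicG3Par (Cb Cb_pos Cb_le sixtyfour_le_Cb)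
open ArchG3Par (G K SdK yloadK G_eq G_pos one_le_K K_pos yloadK_pos)

variable {n : ℕ} (P : ArchG3Rec n)

/-! ### Letters in real form -/

/-- `W_N ≤ W + 2n + log Ω`. [folklore] -/
theorem WN_le : P.WN ≤ P.W + 2 * n + Real.log P.Ω := by
  have h := P.log_N_le
  unfold WN; linarith

/-- `Ŝ ≤ 18n + 60 + 2·log Ω` (`log K ≤ 9n+12`, `log N ≤ 2n + log Ω`, `1/log 2 ≤ 3/2`). [folklore] -/
theorem Sd_real_le : (P.Sd : ℝ) ≤ 18 * n + 60 + 2 * Real.log P.Ω := by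
  have h := P.Sd_log_le.1
  have hK := log_K_le (n := n) P.hn
  have hN := P.log_N_le
  have hl2 := Real.log_two_gt_d9
  have hl2' := Real.log_two_lt_d9
  have hΩ := P.log_Ω_le_sqrt.2.2
  have hn : (0 : ℝ) ≤ n := Nat.cast_nonneg n
  have hl0 : (0 : ℝ) < Real.log 2 := by linarith
  have key : (P.Sd : ℝ) * Real.log 2 ≤ (18 * n + 60 + 2 * Real.log P.Ω) * Real.log 2 := by
    have h1 : (P.Sd : ℝ) * Real.log 2 ≤ (n + 24) * Real.log 2 + 11 * n + 12 + Real.log P.Ω := by linarith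
    nlinarith
  exact le_of_mul_le_mul_right key hl0

/-- `X ≤ 8·W_N + (3/2)(n+1)L/(C_bⁿΩK) + 64(n+1) + 2` (the `max` of the three terms is at most their sum; `G = 8(n+1)`). [folklore] -/
theorem X_real_le : (P.X : ℝ) ≤ 8 * P.WN + (3 / 2) * (n + 1) * P.L / (Cb ^ n * P.Ω * K n) + 64 * (n + 1) + 2 := by
  have hWN := P.WN_bounds.2.2.2
  have hG := G_pos n
  have ha0 : 0 ≤ 64 * (n + 1) * P.WN / G n := by positivity
  have hb0 : 0 ≤ (3 / 2) * (n + 1) * P.L / (Cb ^ n * P.Ω * K n) := by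
    have := P.Ω_facts.1; have := K_pos n; have := Cb_pos; positivity
  have hX : P.X ≤ ⌈64 * (n + 1) * P.WN / G n⌉₊ + ⌈(3 / 2) * (n + 1) * P.L / (Cb ^ n * P.Ω * K n)⌉₊ + 64 * (n + 1) := by
    unfold X; exact max_le (max_le (by omega) (by omega)) (by omega)
  have h1 := (Nat.ceil_lt_add_one ha0).le
  have h2 := (Nat.ceil_lt_add_one hb0).le
  have hX' : (P.X : ℝ) ≤ (⌈64 * (n + 1) * P.WN / G n⌉₊ : ℝ) + (⌈(3 / 2) * (n + 1) * P.L / (Cb ^ n * P.Ω * K n)⌉₊ : ℝ) +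
      64 * (n + 1) := by exact_mod_cast hX
  have e : 64 * (n + 1) * P.WN / G n = 8 * P.WN := by rw [G_eq]; field_simp; ring
  rw [e] at h1 hX'
  linarith

/-- `L ≤ main + 2^{n+25} + 2A_max/N + 4(Ŝ+2) + 3` with `main = 24C_bⁿΩK·yload_K·W/(G·W_N)`. [folklore] -/
theorem L_real_le_sum : (P.L : ℝ) ≤ 24 * Cb ^ n * P.Ω * K n * yloadK n * P.W / (G n * P.WN) + 2 ^ (n + 25) +
    2 * P.Amax / P.N + 4 * (P.Sd + 2) + 3 := by
  have hmain0 : 0 ≤ 24 * Cb ^ n * P.Ω * K n * yloadK n * P.W / (G n * P.WN) := by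
    have := P.Ω_facts.1; have := K_pos n; have := Cb_pos; have := yloadK_pos n; have := G_pos n; have := P.WN_bounds.2.2.2
    have := P.hW; positivity
  have hA0 : 0 ≤ 2 * P.Amax / P.N := by have := P.Ω_facts.2.2.2; have := P.N_facts.1; positivity
  have h2p : 1 ≤ 2 ^ (n + 25) := Nat.one_le_two_pow
  have hL : P.L ≤ ⌈24 * Cb ^ n * P.Ω * K n * yloadK n * P.W / (G n * P.WN)⌉₊ + 2 ^ (n + 25) + (⌈2 * P.Amax / P.N⌉₊ + 1) +
      4 * (P.Sd + 2) := by
    unfold L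
    refine max_le (max_le ?_ ?_) (max_le ?_ ?_)
    · exact le_trans (Nat.le_add_right _ _) (le_trans (Nat.le_add_right _ _) (Nat.le_add_right _ _))
    · calc 2 ^ (n + 25) ≤ ⌈24 * Cb ^ n * P.Ω * K n * yloadK n * P.W / (G n * P.WN)⌉₊ + 2 ^ (n + 25) := Nat.le_add_left _ _
        _ ≤ _ := le_trans (Nat.le_add_right _ _) (Nat.le_add_right _ _)
    · exact le_trans (Nat.le_add_left _ _) (Nat.le_add_right _ _)
    · exact Nat.le_add_left _ _
  have h1 := (Nat.ceil_lt_add_one hmain0).le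
  have h2 := (Nat.ceil_lt_add_one hA0).le
  have hL' : (P.L : ℝ) ≤ (⌈24 * Cb ^ n * P.Ω * K n * yloadK n * P.W / (G n * P.WN)⌉₊ : ℝ) + 2 ^ (n + 25) +
      ((⌈2 * P.Amax / P.N⌉₊ : ℝ) + 1) + 4 * ((P.Sd : ℝ) + 2) := by exact_mod_cast hL
  linarith

/-! ### The balanced unit against `U := C_bⁿ·K·Ω·W` -/

/-- `c_L ≤ 384·C_bⁿK`, i.e. **`L ≤ 384·C_bⁿK·Ω`** (`3ⁿ ≤ C_bⁿ`, `4n + 110 ≤ 2^{n+25}`, `2^{n+26} ≤ 256·C_bⁿK`). [folklore] -/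
theorem L_le_CbK : (P.L : ℝ) ≤ 384 * (Cb ^ n * K n) * P.Ω := by
  have hcL := P.L_le_mul_Omega
  obtain ⟨hΩ0, -, -, -⟩ := P.Ω_facts
  have hK1 : (1 : ℝ) ≤ K n := by exact_mod_cast one_le_K n
  have hK := K_pos n
  have hCb : (0 : ℝ) < Cb ^ n := pow_pos Cb_pos n
  have hG := G_pos n
  have hy5 := yloadK_le_five_G n P.hn
  have hCbK := two_pow_le_CbK (n := n) P.hn
  have h3 : (3 : ℝ) ^ n ≤ Cb ^ n := pow_le_pow_left₀ (by norm_num) (by linarith [sixtyfour_le_Cb]) n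
  have h2n : (n : ℝ) ≤ 2 ^ n := by exact_mod_cast Nat.lt_two_pow_self.le
  have e25 : (2 : ℝ) ^ (n + 25) = 2 ^ n * 2 ^ 25 := by rw [pow_add]
  have e18 : (2 : ℝ) ^ (n + 18) = 2 ^ n * 2 ^ 18 := by rw [pow_add]
  have h1 : 24 * Cb ^ n * K n * yloadK n / G n ≤ 120 * (Cb ^ n * K n) := by
    rw [div_le_iff₀ hG]; have h0 : 0 ≤ 24 * Cb ^ n * K n := by positivity
    nlinarith
  have hcL' : 24 * Cb ^ n * K n * yloadK n / G n + 2 ^ (n + 25) + 4 * K n + 4 * 3 ^ n + 4 * n + 110 ≤ 384 * (Cb ^ n * K n) := by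
    have h3K : 4 * (3 : ℝ) ^ n ≤ 4 * (Cb ^ n * K n) := by nlinarith
    have h4K : 4 * (K n : ℝ) ≤ 4 * (Cb ^ n * K n) := by
      have hCb1 : (1 : ℝ) ≤ Cb ^ n := one_le_pow₀ (by linarith [sixtyfour_le_Cb]); nlinarith
    have h25 : (2 : ℝ) ^ (n + 25) + 4 * n + 110 ≤ 256 * (Cb ^ n * K n) := by
      rw [e25]; rw [e18] at hCbK; nlinarith [one_le_pow₀ (show (1:ℝ) ≤ 2 by norm_num) (n := n)]
    linarith
  exact hcL.trans (mul_le_mul_of_nonneg_right hcL' hΩ0.le)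

/-- **`W_N·L ≤ 1300·(n+1)²·C_bⁿK·Ω·W`** (the balanced design: `W_N` cancels against `main`; `log N/N ≤ 1` in the `A_max/N` floor;
`(log Ω)² ≤ 4Ω` in the depth floor). [cite: Nesterenko2003, §3.5 (3.23)–(3.25); shape only] -/
theorem WN_mul_L_le : P.WN * P.L ≤ 1300 * ((n : ℝ) + 1) ^ 2 * (Cb ^ n * K n) * P.Ω * P.W := by
  obtain ⟨hΩ0, hΩ1, hAΩ, hAmax1⟩ := P.Ω_facts
  obtain ⟨hN0, hN1, hlogN0⟩ := P.N_facts
  obtain ⟨hWN1, hWWN, hNWN, hWN0⟩ := P.WN_bounds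
  have hW := P.hW
  have hG := G_pos n
  have hK := K_pos n
  have hK1 : (1 : ℝ) ≤ K n := by exact_mod_cast one_le_K n
  have hCb : (0 : ℝ) < Cb ^ n := pow_pos Cb_pos n
  have hCb1 : (1 : ℝ) ≤ Cb ^ n := one_le_pow₀ (by linarith [sixtyfour_le_Cb])
  have hy5 := yloadK_le_five_G n P.hn
  have hn0 : (0 : ℝ) ≤ n := Nat.cast_nonneg n
  have hCbK := two_pow_le_CbK (n := n) P.hn
  obtain ⟨hlogΩ, hlogΩ2, hlogΩ0⟩ := P.log_Ω_le_sqrt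
  have hs0 : 0 ≤ √P.Ω := Real.sqrt_nonneg _
  have hss : √P.Ω * √P.Ω = P.Ω := Real.mul_self_sqrt hΩ0.le
  have hsqrt1 : 1 ≤ √P.Ω := by rw [← Real.sqrt_one]; exact Real.sqrt_le_sqrt hΩ1
  have hsqrt : √P.Ω ≤ P.Ω := by nlinarith
  have hWN := P.WN_le
  have hSd := P.Sd_real_le
  have hL := P.L_real_le_sum
  -- the unit
  set U : ℝ := Cb ^ n * K n * (P.Ω * P.W) with hU
  have hΩW1 : 1 ≤ P.Ω * P.W := one_le_mul_of_one_le_of_one_le hΩ1 hW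
  have hΩW : P.Ω * P.W ≤ U := by rw [hU]; exact le_mul_of_one_le_left (by positivity) (one_le_mul_of_one_le_of_one_le hCb1 hK1)
  have hU0 : 0 ≤ U := by positivity
  have hWΩW : P.W ≤ P.Ω * P.W := le_mul_of_one_le_left (by linarith) hΩ1
  have hΩΩW : P.Ω ≤ P.Ω * P.W := le_mul_of_one_le_right hΩ0.le hW
  have hsΩW : √P.Ω ≤ P.Ω * P.W := hsqrt.trans hΩΩW
  -- `W_N ≤ (2n+3)·ΩW`
  have hWNΩ : P.WN ≤ (2 * n + 3) * (P.Ω * P.W) := by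
    have h1 : P.WN ≤ P.W + 2 * n + 2 * P.Ω := by linarith
    have h2 : (2 : ℝ) * n ≤ 2 * n * (P.Ω * P.W) := le_mul_of_one_le_right (by positivity) hΩW1
    linarith
  -- (1) `W_N·main = 24C_bⁿΩK·W·(yload_K/G) ≤ 120 U`
  have h1 : P.WN * (24 * Cb ^ n * P.Ω * K n * yloadK n * P.W / (G n * P.WN)) ≤ 120 * U := by
    have e : P.WN * (24 * Cb ^ n * P.Ω * K n * yloadK n * P.W / (G n * P.WN)) = 24 * U * (yloadK n / G n) := by
      rw [hU]; field_simp
    rw [e]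
    have hyg : yloadK n / G n ≤ 5 := by rw [div_le_iff₀ hG]; linarith
    have := mul_le_mul_of_nonneg_left hyg (show 0 ≤ 24 * U by positivity)
    linarith
  -- (2) `W_N·2^{n+25} ≤ (2n+3)·128·U`
  have h2 : P.WN * 2 ^ (n + 25) ≤ 128 * (2 * n + 3) * U := by
    have e25 : (2 : ℝ) ^ (n + 25) = 2 ^ (n + 18) * 128 := by rw [show n + 25 = (n + 18) + 7 by ring, pow_add]; norm_num
    have hpU : 2 ^ (n + 18) * (P.Ω * P.W) ≤ U := by rw [hU]; exact mul_le_mul_of_nonneg_right hCbK (by positivity)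
    rw [e25]
    have h0 : (0 : ℝ) ≤ 2 * n + 3 := by positivity
    calc P.WN * (2 ^ (n + 18) * 128) ≤ ((2 * n + 3) * (P.Ω * P.W)) * (2 ^ (n + 18) * 128) :=
          mul_le_mul_of_nonneg_right hWNΩ (by positivity)
      _ = 128 * (2 * n + 3) * (2 ^ (n + 18) * (P.Ω * P.W)) := by ring
      _ ≤ 128 * (2 * n + 3) * U := mul_le_mul_of_nonneg_left hpU (by positivity)
  -- (3) `W_N·2A_max/N ≤ 4·U` (`log N ≤ N`)
  have h3 : P.WN * (2 * P.Amax / P.N) ≤ 4 * U := by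
    have hlogNN : Real.log P.N ≤ P.N := (Real.log_le_sub_one_of_pos hN0).trans (by linarith)
    unfold WN
    have e : (P.W + Real.log P.N) * (2 * P.Amax / P.N) = 2 * P.Amax * P.W / P.N + 2 * P.Amax * (Real.log P.N / P.N) := by ring
    rw [e]
    have ha : 2 * P.Amax * P.W / P.N ≤ 2 * P.Amax * P.W := div_le_self (by positivity) hN1
    have hb : Real.log P.N / P.N ≤ 1 := by rw [div_le_one hN0]; exact hlogNN
    have hc : 2 * P.Amax * (Real.log P.N / P.N) ≤ 2 * P.Amax * 1 := mul_le_mul_of_nonneg_left hb (by positivity)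
    have hd : 2 * P.Amax * P.W ≤ 2 * (P.Ω * P.W) := by nlinarith
    have he : 2 * P.Amax ≤ 2 * (P.Ω * P.W) := by linarith
    linarith
  -- (4) `W_N·4(Ŝ+2) ≤ 776(n+1)²·U`
  have h4 : P.WN * (4 * ((P.Sd : ℝ) + 2)) ≤ 776 * ((n : ℝ) + 1) ^ 2 * U := by
    have hWN' : P.WN ≤ P.W + 2 * n + 2 * √P.Ω := by linarith only [hWN, hlogΩ]
    have hSd' : 4 * ((P.Sd : ℝ) + 2) ≤ 72 * n + 248 + 16 * √P.Ω := by linarith only [hSd, hlogΩ]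
    have hA : P.WN * (4 * ((P.Sd : ℝ) + 2)) ≤ (P.W + 2 * n + 2 * √P.Ω) * (72 * n + 248 + 16 * √P.Ω) :=
      mul_le_mul hWN' hSd' (by positivity) (by positivity)
    refine hA.trans ?_
    have hWs : P.W * √P.Ω ≤ P.Ω * P.W := by
      calc P.W * √P.Ω ≤ P.W * P.Ω := mul_le_mul_of_nonneg_left hsqrt (by linarith only [hW])
        _ = P.Ω * P.W := mul_comm _ _
    -- expand and bound each monomial by a multiple of `ΩW ≤ U`
    have hexp : (P.W + 2 * n + 2 * √P.Ω) * (72 * n + 248 + 16 * √P.Ω) =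
        (72 * n + 248) * P.W + 16 * (P.W * √P.Ω) + (2 * n) * (72 * n + 248) + (32 * n) * √P.Ω +
        (144 * n + 496) * √P.Ω + 32 * (√P.Ω * √P.Ω) := by ring
    rw [hexp, hss]
    set V : ℝ := P.Ω * P.W with hV
    have hV0 : 0 ≤ V := by positivity
    -- each monomial against `V = ΩW ≤ U`
    have t1 : (72 * n + 248) * P.W ≤ (72 * n + 248) * V := mul_le_mul_of_nonneg_left hWΩW (by positivity)
    have t2 : 16 * (P.W * √P.Ω) ≤ 16 * V := by linarith only [hWs]
    have t3 : (2 * n) * (72 * n + 248) ≤ (2 * n) * (72 * n + 248) * V :=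
      le_mul_of_one_le_right (by positivity) hΩW1
    have t4 : (32 * n) * √P.Ω ≤ (32 * n) * V := mul_le_mul_of_nonneg_left hsΩW (by positivity)
    have t5 : (144 * n + 496) * √P.Ω ≤ (144 * n + 496) * V := mul_le_mul_of_nonneg_left hsΩW (by positivity)
    have t6 : 32 * P.Ω ≤ 32 * V := by linarith only [hΩΩW]
    have hVU : V ≤ U := hΩW
    have s1 : (n : ℝ) * V ≤ n * U := mul_le_mul_of_nonneg_left hVU hn0
    have s2 : (n : ℝ) ^ 2 * V ≤ (n : ℝ) ^ 2 * U := mul_le_mul_of_nonneg_left hVU (by positivity)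
    have s0 : 0 ≤ (n : ℝ) * U := by positivity
    have s3 : 0 ≤ (n : ℝ) ^ 2 * U := by positivity
    have hn1 : (1 : ℝ) ≤ n := by exact_mod_cast P.hn
    have s4 : U ≤ (n : ℝ) * U := le_mul_of_one_le_left hU0 hn1
    linarith only [t1, t2, t3, t4, t5, t6, hVU, s1, s2, s0, s3, s4, hV0, hn0, hU0]
  -- (5) `W_N·3 ≤ 9(n+1)·U`
  have h5 : P.WN * 3 ≤ 9 * ((n : ℝ) + 1) * U := by
    have h1 : P.WN * 3 ≤ 3 * ((2 * n + 3) * (P.Ω * P.W)) := by linarith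
    have h2 : (2 * n + 3) * (P.Ω * P.W) ≤ (2 * (n : ℝ) + 3) * U := mul_le_mul_of_nonneg_left hΩW (by positivity)
    have s0 : 0 ≤ (n : ℝ) * U := by positivity
    linarith
  -- assemble
  have hsum : P.WN * P.L ≤ P.WN * (24 * Cb ^ n * P.Ω * K n * yloadK n * P.W / (G n * P.WN)) + P.WN * 2 ^ (n + 25) +
      P.WN * (2 * P.Amax / P.N) + P.WN * (4 * ((P.Sd : ℝ) + 2)) + P.WN * 3 := by
    have := mul_le_mul_of_nonneg_left hL hWN0.le
    linarith
  have s0 : 0 ≤ (n : ℝ) * U := by positivity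
  have s3 : 0 ≤ (n : ℝ) ^ 2 * U := by positivity
  have e : 1300 * ((n : ℝ) + 1) ^ 2 * (Cb ^ n * K n) * P.Ω * P.W = 1300 * (((n : ℝ) + 1) ^ 2 * U) := by rw [hU]; ring
  rw [e]
  linarith only [hsum, h1, h2, h3, h4, h5, s0, s3, hU0, hn0]

/-- **THE BALANCED UNIT AGAINST `Ω·W`**: `X·L ≤ 2^{18}·(n+1)²·C_bⁿK·Ω·W`. [cite: Nesterenko2003, §3.5 (3.23)–(3.25); shape only] -/
theorem XL_le : (P.X : ℝ) * P.L ≤ 2 ^ 18 * ((n : ℝ) + 1) ^ 2 * (Cb ^ n * K n) * P.Ω * P.W := by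
  obtain ⟨hΩ0, hΩ1, -, -⟩ := P.Ω_facts
  obtain ⟨hL1, hL0, -, -⟩ := P.L_real
  have hW := P.hW
  have hK := K_pos n
  have hK1 : (1 : ℝ) ≤ K n := by exact_mod_cast one_le_K n
  have hCb : (0 : ℝ) < Cb ^ n := pow_pos Cb_pos n
  have hCb1 : (1 : ℝ) ≤ Cb ^ n := one_le_pow₀ (by linarith [sixtyfour_le_Cb])
  have hn0 : (0 : ℝ) ≤ n := Nat.cast_nonneg n
  have hWN0 := P.WN_bounds.2.2.2
  have hX := P.X_real_le
  have hLK := P.L_le_CbK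
  have hWNL := P.WN_mul_L_le
  set U : ℝ := Cb ^ n * K n * (P.Ω * P.W) with hU
  have hU0 : 0 ≤ U := by positivity
  have hLU : (P.L : ℝ) ≤ 384 * U := by
    calc (P.L : ℝ) ≤ 384 * (Cb ^ n * K n) * P.Ω := hLK
      _ ≤ 384 * (Cb ^ n * K n) * (P.Ω * P.W) := by
          have : (Cb ^ n * K n) * P.Ω ≤ (Cb ^ n * K n) * (P.Ω * P.W) :=
            mul_le_mul_of_nonneg_left (le_mul_of_one_le_right hΩ0.le hW) (by positivity)
          nlinarith
      _ = 384 * U := by rw [hU]; ring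
  -- `b := (3/2)(n+1) L/(C_bⁿΩK) ≤ 576(n+1)`
  have hb : (3 / 2) * (n + 1) * P.L / (Cb ^ n * P.Ω * K n) ≤ 576 * ((n : ℝ) + 1) := by
    have hq : (P.L : ℝ) / (Cb ^ n * P.Ω * K n) ≤ 384 := by
      rw [div_le_iff₀ (by positivity)]; nlinarith
    have e : (3 / 2) * (n + 1) * P.L / (Cb ^ n * P.Ω * K n) = (3 / 2) * ((n : ℝ) + 1) * (P.L / (Cb ^ n * P.Ω * K n)) := by ring
    rw [e]; nlinarith
  have hX' : (P.X : ℝ) ≤ 8 * P.WN + 642 * ((n : ℝ) + 1) := by nlinarith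
  have hWNL' : P.WN * P.L ≤ 1300 * ((n : ℝ) + 1) ^ 2 * U := by
    have e : 1300 * ((n : ℝ) + 1) ^ 2 * (Cb ^ n * K n) * P.Ω * P.W = 1300 * ((n : ℝ) + 1) ^ 2 * U := by rw [hU]; ring
    rw [← e]; exact hWNL
  have e : (2 : ℝ) ^ 18 * ((n : ℝ) + 1) ^ 2 * (Cb ^ n * K n) * P.Ω * P.W = 262144 * ((n : ℝ) + 1) ^ 2 * U := by rw [hU]; norm_num; ring
  rw [e]
  have s0 : 0 ≤ (n : ℝ) * U := by positivity
  have s3 : 0 ≤ (n : ℝ) ^ 2 * U := by positivity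
  calc (P.X : ℝ) * P.L ≤ (8 * P.WN + 642 * ((n : ℝ) + 1)) * P.L := mul_le_mul_of_nonneg_right hX' hL0.le
    _ = 8 * (P.WN * P.L) + 642 * ((n : ℝ) + 1) * P.L := by ring
    _ ≤ 8 * (1300 * ((n : ℝ) + 1) ^ 2 * U) + 642 * ((n : ℝ) + 1) * (384 * U) := by
        have h2 : 642 * ((n : ℝ) + 1) * P.L ≤ 642 * ((n : ℝ) + 1) * (384 * U) := mul_le_mul_of_nonneg_left hLU (by positivity)
        linarith
    _ ≤ 262144 * ((n : ℝ) + 1) ^ 2 * U := by linarith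

/-- **`Z ≤ 2^{21}·(n+1)³·C_bⁿK·Ω·W`** (`Z = G·X·L`, `G = 8(n+1)`). [folklore] -/
theorem Z_le : P.Z ≤ 2 ^ 21 * ((n : ℝ) + 1) ^ 3 * (Cb ^ n * K n) * P.Ω * P.W := by
  have h := P.XL_le
  unfold Z; rw [G_eq]
  have hn0 : (0 : ℝ) ≤ (n : ℝ) + 1 := by positivity
  have := mul_le_mul_of_nonneg_left h (show (0:ℝ) ≤ 8 * ((n:ℝ) + 1) by positivity)
  have e : 8 * ((n : ℝ) + 1) * (2 ^ 18 * ((n : ℝ) + 1) ^ 2 * (Cb ^ n * K n) * P.Ω * P.W) =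
      2 ^ 21 * ((n : ℝ) + 1) ^ 3 * (Cb ^ n * K n) * P.Ω * P.W := by ring
  linarith

/-- **`2^{40n}·Z ≤ cⁿ·Ω·W` for `c ≥ 2^100`** (`C_bⁿK ≤ 2^{7n}·2^{13n+16}`, `(n+1)³ ≤ 2^{3n}`): every cost `≤ 2^{40n}·Z` is paid by the negated
bound `U₀ = cⁿ·Ω·W`. [folklore] -/
theorem Z_le_U0 (k : ℕ) {c : ℝ} (hc : (2 : ℝ) ^ (k + 60) ≤ c) : 2 ^ (k * n) * P.Z ≤ c ^ n * P.Ω * P.W := by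
  have hZ := P.Z_le
  obtain ⟨hΩ0, -, -, -⟩ := P.Ω_facts
  have hW := P.hW
  have hP0 : (0 : ℝ) ≤ P.Ω * P.W := by positivity
  have hcn : ((2 : ℝ) ^ (k + 60)) ^ n ≤ c ^ n := pow_le_pow_left₀ (by positivity) hc n
  have hCb : Cb ^ n ≤ (2 : ℝ) ^ (7 * n) := by
    rw [pow_mul]; exact pow_le_pow_left₀ Cb_pos.le (by linarith [Cb_le]) n
  have hK : (K n : ℝ) ≤ 2 ^ (13 * n + 16) := by
    have h1 : (K n : ℝ) ≤ ((n * 22027 * 2981 ^ n + 2 : ℕ) : ℝ) := by exact_mod_cast K_le_Knat n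
    have h2 : ((n * 22027 * 2981 ^ n + 2 : ℕ) : ℝ) ≤ ((2 ^ (13 * n + 16) : ℕ) : ℝ) := by exact_mod_cast (Knat_lt_two_pow n).le
    have h3 := h1.trans h2
    push_cast at h3; exact h3
  have hn3 : ((n : ℝ) + 1) ^ 3 ≤ 2 ^ (3 * n) := by
    have h : ((n + 1 : ℕ) : ℝ) ≤ ((2 ^ n : ℕ) : ℝ) := by exact_mod_cast Nat.lt_two_pow_self
    push_cast at h
    rw [pow_mul]
    calc ((n : ℝ) + 1) ^ 3 ≤ (2 ^ n) ^ 3 := pow_le_pow_left₀ (by positivity) h 3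
      _ = (2 ^ 3) ^ n := by rw [← pow_mul, ← pow_mul, mul_comm]
  have hCK0 : (0 : ℝ) ≤ Cb ^ n * K n := by have := K_pos n; have := Cb_pos; positivity
  have h1 : 2 ^ 21 * ((n : ℝ) + 1) ^ 3 * (Cb ^ n * K n) ≤ 2 ^ 21 * 2 ^ (3 * n) * (2 ^ (7 * n) * 2 ^ (13 * n + 16)) :=
    mul_le_mul (mul_le_mul_of_nonneg_left hn3 (by positivity)) (mul_le_mul hCb hK (K_pos n).le (by positivity)) hCK0 (by positivity)
  have e : (2 : ℝ) ^ 21 * 2 ^ (3 * n) * (2 ^ (7 * n) * 2 ^ (13 * n + 16)) = 2 ^ (23 * n + 37) := by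
    simp only [← pow_add]; ring_nf
  have h2 : (2 : ℝ) ^ (k * n) * 2 ^ (23 * n + 37) ≤ (2 ^ (k + 60)) ^ n := by
    rw [← pow_add, ← pow_mul]; exact pow_le_pow_right₀ (by norm_num) (by have := P.hn; nlinarith)
  calc 2 ^ (k * n) * P.Z ≤ 2 ^ (k * n) * (2 ^ 21 * ((n : ℝ) + 1) ^ 3 * (Cb ^ n * K n) * P.Ω * P.W) :=
        mul_le_mul_of_nonneg_left hZ (by positivity)
    _ = (2 ^ (k * n) * (2 ^ 21 * ((n : ℝ) + 1) ^ 3 * (Cb ^ n * K n))) * (P.Ω * P.W) := by ring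
    _ ≤ (2 ^ (k * n) * 2 ^ (23 * n + 37)) * (P.Ω * P.W) := by
        rw [← e]; exact mul_le_mul_of_nonneg_right (mul_le_mul_of_nonneg_left h1 (by positivity)) hP0
    _ ≤ (2 ^ (k + 60)) ^ n * (P.Ω * P.W) := mul_le_mul_of_nonneg_right h2 hP0
    _ ≤ c ^ n * (P.Ω * P.W) := mul_le_mul_of_nonneg_right hcn hP0
    _ = c ^ n * P.Ω * P.W := by ring

/-- **THE U₀-DOMINATION LEMMA (plan R50 shape, seat p4)**: `2^{k·n}·Z ≤ U₀(c) = cⁿ·Ω·W` whenever `c ≥ 2^{k+60}` — a family file of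
`LinesClosedK` that bounds its (J)/(C)/smallness costs by `2^{k·n}·Z` (explicit `k`) carries `(hU0 : 2^(k*n)·P.Z ≤ P.U0 c)`, discharged here;
the line's floor is `c₀ := 2^{k_max+60}`. [folklore] -/
theorem U0_ge (k : ℕ) {c : ℝ} (hc : (2 : ℝ) ^ (k + 60) ≤ c) : (2 : ℝ) ^ (k * n) * P.Z ≤ P.U0 c := P.Z_le_U0 k hc

/-- The U₀-domination in the `U = C_bⁿK·Ω·W` currency: `2^{k·n}·(C_bⁿ·K·(Ω·W)) ≤ U₀(c)` for `c ≥ 2^{k+36}` (`C_bⁿK ≤ 2^{20n+16} ≤ 2^{36n}`).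
[folklore] -/
theorem U_le_U0 (k : ℕ) {c : ℝ} (hc : (2 : ℝ) ^ (k + 36) ≤ c) : (2 : ℝ) ^ (k * n) * (Cb ^ n * K n * (P.Ω * P.W)) ≤ P.U0 c := by
  obtain ⟨hΩ0, -, -, -⟩ := P.Ω_facts
  have hW := P.hW
  have hP0 : (0 : ℝ) ≤ P.Ω * P.W := by positivity
  have hcn : ((2 : ℝ) ^ (k + 36)) ^ n ≤ c ^ n := pow_le_pow_left₀ (by positivity) hc n
  have hCb : Cb ^ n ≤ (2 : ℝ) ^ (7 * n) := by
    rw [pow_mul]; exact pow_le_pow_left₀ Cb_pos.le (by linarith [Cb_le]) n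
  have hK : (K n : ℝ) ≤ 2 ^ (13 * n + 16) := by
    have h1 : (K n : ℝ) ≤ ((n * 22027 * 2981 ^ n + 2 : ℕ) : ℝ) := by exact_mod_cast K_le_Knat n
    have h2 : ((n * 22027 * 2981 ^ n + 2 : ℕ) : ℝ) ≤ ((2 ^ (13 * n + 16) : ℕ) : ℝ) := by exact_mod_cast (Knat_lt_two_pow n).le
    have h3 := h1.trans h2
    push_cast at h3; exact h3
  have h1 : Cb ^ n * (K n : ℝ) ≤ 2 ^ (7 * n) * 2 ^ (13 * n + 16) := mul_le_mul hCb hK (K_pos n).le (by positivity)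
  have h2 : (2 : ℝ) ^ (k * n) * (2 ^ (7 * n) * 2 ^ (13 * n + 16)) ≤ (2 ^ (k + 36)) ^ n := by
    rw [← pow_add, ← pow_add, ← pow_mul]; exact pow_le_pow_right₀ (by norm_num) (by have := P.hn; nlinarith)
  unfold U0
  calc (2 : ℝ) ^ (k * n) * (Cb ^ n * K n * (P.Ω * P.W)) = (2 ^ (k * n) * (Cb ^ n * K n)) * (P.Ω * P.W) := by ring
    _ ≤ (2 ^ (k * n) * (2 ^ (7 * n) * 2 ^ (13 * n + 16))) * (P.Ω * P.W) :=
        mul_le_mul_of_nonneg_right (mul_le_mul_of_nonneg_left h1 (by positivity)) hP0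
    _ ≤ (2 ^ (k + 36)) ^ n * (P.Ω * P.W) := mul_le_mul_of_nonneg_right h2 hP0
    _ ≤ c ^ n * (P.Ω * P.W) := mul_le_mul_of_nonneg_right hcn hP0
    _ = c ^ n * P.Ω * P.W := by ring

end ArchG3Rec

end Summit.ABC.StewartYu

end
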